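import Summits.Parity.GeneralizedHardyLittlewood.Theorems.ModelHyperbolicity.Negative.ModelHyperbolicityLoadBearing

/-!
# `ModelHyperbolicity` (stmt-Parity-14110): integer thresholds, the reduced polynomial, the
# sign-alternation TRANSFER, the trivial cases `u = 2, 3`, and NON-MONOTONICITY in `x`

Part 3 of the cdisprove seat's lemmas for the crux `LeeYangFibres.ModelHyperbolicity` (parts 1–2:
`ModelHyperbolicityLoadBearing`, `ModelHyperbolicityUniformFalse`).
* Tools: `threshold_lt_minFac_iff_le` / `cell_eq_of_window` (`(B−1)^u ≤ x < B^u ⇒ (x^{1/u} < P⁻(n) ↔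
  B ≤ P⁻(n))`: every concrete cell becomes a `simp`/`norm_num` computation), `cell_zero` (`A₀ = 0`),
  `cell_eq_zero_of_le` (`A_j = 0` for `j ≥ u`), the REDUCED real polynomial `cellPolyQ`
  (`P_{u,x}(z) = z·Q_{u,x}(z)`, `cellPoly_eq_mul_Q`, `natDegree_cellPolyQ_le : deg Q ≤ u − 2`).
* TRANSFER (the last step of the prover route "Alladi asymptotics + simple real zeros of the limit
  polynomial"): `realRootedAt_of_alternating` — strict sign alternation of `Q_{u,x}` at `d + 1`
  increasing reals with `deg Q ≤ d`, `d ≥ 1` ⇒ `RealRootedAt u x` (IVT count `le_card_roots_of_alternating`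
  + `im_eq_zero_of_natDegree_le_card_roots`); and `realRootedAt_of_natDegree_le_one`.
* (B1) `realRootedAt_two`, `realRootedAt_three`: the crux at `u = 2, 3` for all `x ≥ 2` (Bertrand).
* (C1) NEGATIVE: real-rootedness is NOT monotone in `x` — `u = 4`: `x = 26` is real-rooted
  (`8z + 4z²`), `x = 27` is not (`8z + 4z² + z³`): `not_monotone_in_x`. [folklore]
-/

namespace Summit.Parity.GeneralizedHardyLittlewood.Theorems.ModelHyperbolicity.Negative

open Summit.Parity.GeneralizedHardyLittlewood.Theses.LeeYangFibres
open Finset Polynomial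
open scoped Classical

/-! ## §F Prover-facing tools: integer form of the threshold, top cells vanish, and the TRANSFER
`sign alternation of the reduced real cell polynomial at u − 1 points ⇒ RealRootedAt u x` -/

/-- INTEGER THRESHOLD: if `(B-1)^u ≤ x < B^u` then `x^{1/u} < P⁻(n) ↔ B ≤ P⁻(n)`. -/
theorem threshold_lt_minFac_iff_le {x u B : ℕ} (hlo : (B - 1) ^ u ≤ x) (hhi : x < B ^ u) (hu : 0 < u)
    (n : ℕ) : (x : ℝ) ^ ((1 : ℝ) / u) < (Nat.minFac n : ℝ) ↔ B ≤ Nat.minFac n := by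
  have hu' : (0 : ℝ) < (u : ℝ) := Nat.cast_pos.mpr hu
  have h1 : (x : ℝ) ^ ((1 : ℝ) / u) < B := by
    rw [one_div, Real.rpow_inv_lt_iff_of_pos (Nat.cast_nonneg _) (Nat.cast_nonneg _) hu',
      Real.rpow_natCast]
    exact_mod_cast hhi
  have h2 : ((B - 1 : ℕ) : ℝ) ≤ (x : ℝ) ^ ((1 : ℝ) / u) := by
    rw [one_div, Real.le_rpow_inv_iff_of_pos (Nat.cast_nonneg _) (Nat.cast_nonneg _) hu',
      Real.rpow_natCast]
    exact_mod_cast hlo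
  constructor
  · intro h
    have : ((B - 1 : ℕ) : ℝ) < Nat.minFac n := lt_of_le_of_lt h2 h
    have : B - 1 < Nat.minFac n := by exact_mod_cast this
    omega
  · intro h
    exact lt_of_lt_of_le h1 (by exact_mod_cast h)

/-- With an integer threshold the cell is a decidable count: `A_j(x) = #{n ≤ x : B ≤ P⁻(n), Ω(n) = j}`. -/
theorem cell_eq_of_window {x u B : ℕ} (hlo : (B - 1) ^ u ≤ x) (hhi : x < B ^ u) (hu : 0 < u) (j : ℕ) :
    cell u x j = ((Finset.Icc 1 x).filter (fun n => B ≤ Nat.minFac n ∧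
      ArithmeticFunction.cardFactors n = j)).card := by
  unfold cell
  congr 1
  exact Finset.filter_congr fun n _ => by rw [threshold_lt_minFac_iff_le hlo hhi hu]

/-- `P⁻(n)^{Ω(n)} ≤ n` for `n ≠ 0`. -/
theorem minFac_pow_cardFactors_le {n : ℕ} (hn : n ≠ 0) :
    Nat.minFac n ^ ArithmeticFunction.cardFactors n ≤ n := by
  rw [ArithmeticFunction.cardFactors_apply]
  conv_rhs => rw [← Nat.prod_primeFactorsList hn]
  exact List.pow_card_le_prod _ _ fun p hp =>
    Nat.minFac_le_of_dvd (Nat.prime_of_mem_primeFactorsList hp).two_le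
      (Nat.dvd_of_mem_primeFactorsList hp)

/-- The always-empty cells: `A_0(x) = 0` … -/
theorem cell_zero (u x : ℕ) : cell u x 0 = 0 := by
  unfold cell
  rw [Finset.card_eq_zero, Finset.filter_eq_empty_iff]
  rintro n hn ⟨hlt, hΩ⟩
  rw [Finset.mem_Icc] at hn
  rcases ArithmeticFunction.cardFactors_eq_zero_iff_eq_zero_or_one.mp hΩ with rfl | rfl
  · omega
  · rw [Nat.minFac_one, Nat.cast_one] at hlt
    exact absurd (one_le_threshold u hn.2) (not_le.mpr hlt)

/-- … and `A_j(x) = 0` for `j ≥ u ≥ 1`: `u` prime factors above `x^{1/u}` do not fit below `x`. -/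
theorem cell_eq_zero_of_le {u x j : ℕ} (hu : 1 ≤ u) (hj : u ≤ j) : cell u x j = 0 := by
  unfold cell
  rw [Finset.card_eq_zero, Finset.filter_eq_empty_iff]
  rintro n hn ⟨hlt, hΩ⟩
  rw [Finset.mem_Icc] at hn
  have hn0 : n ≠ 0 := by omega
  have hmf : (Nat.minFac n : ℝ) ^ u ≤ n := by
    have h1 : Nat.minFac n ^ j ≤ n := hΩ ▸ minFac_pow_cardFactors_le hn0
    have h2 : Nat.minFac n ^ u ≤ Nat.minFac n ^ j := Nat.pow_le_pow_right (Nat.minFac_pos n) hj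
    exact_mod_cast h2.trans h1
  have hx0 : (0 : ℝ) ≤ (x : ℝ) ^ ((1 : ℝ) / u) := by positivity
  have hlt' : ((x : ℝ) ^ ((1 : ℝ) / u)) ^ u < (Nat.minFac n : ℝ) ^ u :=
    pow_lt_pow_left₀ hlt hx0 (by omega)
  rw [one_div, Real.rpow_inv_natCast_pow (Nat.cast_nonneg _) (by omega)] at hlt'
  have : (n : ℝ) ≤ x := by exact_mod_cast hn.2
  linarith

/-- The REDUCED real cell polynomial `Q_{u,x} = Σ_{j<u} A_{j+1}(x) X^j ∈ ℝ[X]` (`P_{u,x}(z) = z·Q_{u,x}(z)`). -/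
noncomputable def cellPolyQ (u x : ℕ) : ℝ[X] :=
  ∑ j ∈ Finset.range u, C ((cell u x (j + 1) : ℕ) : ℝ) * X ^ j
/-- Coefficients of the reduced polynomial: `A_{i+1}` for `i < u`. -/

theorem cellPolyQ_coeff (u x i : ℕ) :
    (cellPolyQ u x).coeff i = if i < u then ((cell u x (i + 1) : ℕ) : ℝ) else 0 := by
  unfold cellPolyQ
  rw [finsetSum_coeff]
  simp only [coeff_C_mul_X_pow]
  rw [Finset.sum_ite_eq]
  simp [Finset.mem_range]
/-- Evaluation of the reduced polynomial over `ℝ`. -/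

theorem cellPolyQ_eval (u x : ℕ) (t : ℝ) :
    (cellPolyQ u x).eval t = ∑ j ∈ Finset.range u, ((cell u x (j + 1) : ℕ) : ℝ) * t ^ j := by
  unfold cellPolyQ
  rw [eval_finsetSum]
  simp only [eval_mul, eval_C, eval_pow, eval_X]
/-- Evaluation of the reduced polynomial pushed to `ℂ`. -/

theorem cellPolyQ_map_eval (u x : ℕ) (z : ℂ) :
    ((cellPolyQ u x).map (algebraMap ℝ ℂ)).eval z = ∑ j ∈ Finset.range u, ((cell u x (j + 1) : ℕ) : ℂ) * z ^ j := by
  unfold cellPolyQ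
  rw [Polynomial.map_sum, eval_finsetSum]
  simp only [Polynomial.map_mul, Polynomial.map_C, Polynomial.map_pow, Polynomial.map_X, eval_mul, eval_C,
    eval_pow, eval_X, Complex.coe_algebraMap, Complex.ofReal_natCast]

/-- `P_{u,x}(z) = z · Q_{u,x}(z)`. -/
theorem cellPoly_eq_mul_Q (u x : ℕ) (z : ℂ) :
    cellPoly u x z = z * ((cellPolyQ u x).map (algebraMap ℝ ℂ)).eval z := by
  rw [cellPolyQ_map_eval, cellPoly, Finset.sum_range_succ', cell_zero, Finset.mul_sum]
  simp only [Nat.cast_zero, zero_mul, add_zero, pow_zero]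
  refine Finset.sum_congr rfl fun j _ => ?_
  ring

/-- The reduced polynomial has degree `≤ u − 2` (`A_u = 0`). -/
theorem natDegree_cellPolyQ_le (u x : ℕ) (hu : 1 ≤ u) : (cellPolyQ u x).natDegree ≤ u - 2 := by
  rw [natDegree_le_iff_coeff_eq_zero]
  intro N hN
  rw [cellPolyQ_coeff]
  split_ifs with h
  · rw [cell_eq_zero_of_le hu (by omega)]
    simp
  · rfl

/-- TRANSFER, polynomial core: a real polynomial with as many real roots as its degree has only
real complex roots. -/
theorem im_eq_zero_of_natDegree_le_card_roots {p : ℝ[X]} (hp : p ≠ 0)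
    (hcard : p.natDegree ≤ p.roots.card) {z : ℂ} (hz : (p.map (algebraMap ℝ ℂ)).eval z = 0) :
    z.im = 0 := by
  have hsplit : p.roots.card = p.natDegree := le_antisymm (card_roots' p) hcard
  have hroots : p.roots.map (algebraMap ℝ ℂ) = (p.map (algebraMap ℝ ℂ)).roots :=
    roots_map_of_injective_of_card_eq_natDegree (algebraMap ℝ ℂ).injective hsplit
  have hmap0 : p.map (algebraMap ℝ ℂ) ≠ 0 := (Polynomial.map_ne_zero_iff (algebraMap ℝ ℂ).injective).mpr hp
  have hzmem : z ∈ (p.map (algebraMap ℝ ℂ)).roots := (mem_roots hmap0).mpr hz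
  rw [← hroots, Multiset.mem_map] at hzmem
  obtain ⟨r, -, rfl⟩ := hzmem
  simp

/-- IVT COUNT: strict sign alternation at `d + 1` increasing points gives `d` real roots. -/
theorem le_card_roots_of_alternating (p : ℝ[X]) {d : ℕ} (t : ℕ → ℝ)
    (ht : ∀ i < d, t i < t (i + 1)) (hsign : ∀ i < d, p.eval (t i) * p.eval (t (i + 1)) < 0)
    (hp : p ≠ 0) : d ≤ p.roots.card := by
  have hex : ∀ i < d, ∃ r, t i < r ∧ r < t (i + 1) ∧ p.IsRoot r := by
    intro i hi
    have hcont : ContinuousOn (fun s => p.eval s) (Set.Icc (t i) (t (i + 1))) :=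
      p.continuous.continuousOn
    rcases mul_neg_iff.mp (hsign i hi) with ⟨ha, hb⟩ | ⟨ha, hb⟩
    · obtain ⟨r, hr, hr0⟩ := intermediate_value_Ioo' (ht i hi).le hcont ⟨hb, ha⟩
      exact ⟨r, hr.1, hr.2, hr0⟩
    · obtain ⟨r, hr, hr0⟩ := intermediate_value_Ioo (ht i hi).le hcont ⟨ha, hb⟩
      exact ⟨r, hr.1, hr.2, hr0⟩
  choose! r hr using hex
  have htmono : ∀ n i, i + n ≤ d → t i ≤ t (i + n) := by
    intro n
    induction n with
    | zero => intro i _; simp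
    | succ n ih =>
      intro i hi
      calc t i ≤ t (i + n) := ih i (by omega)
        _ ≤ t (i + n + 1) := (ht (i + n) (by omega)).le
  have hrmono : ∀ i j, i < j → j < d → r i < r j := by
    intro i j hij hjd
    calc r i < t (i + 1) := (hr i (by omega)).2.1
      _ ≤ t (i + 1 + (j - (i + 1))) := htmono _ _ (by omega)
      _ = t j := by rw [show i + 1 + (j - (i + 1)) = j by omega]
      _ < r j := (hr j hjd).1
  have hinj : Set.InjOn r (Finset.range d : Set ℕ) := by
    intro i hi j hj hij
    simp only [Finset.coe_range, Set.mem_Iio] at hi hj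
    by_contra hne
    rcases lt_or_gt_of_ne hne with h | h
    · exact absurd hij (hrmono i j h hj).ne
    · exact absurd hij.symm (hrmono j i h hi).ne
  calc d = ((Finset.range d).image r).card := by rw [Finset.card_image_of_injOn hinj, Finset.card_range]
    _ ≤ p.roots.toFinset.card := by
        refine Finset.card_le_card fun s hs => ?_
        obtain ⟨i, hi, rfl⟩ := Finset.mem_image.mp hs
        rw [Multiset.mem_toFinset, mem_roots hp]
        exact (hr i (Finset.mem_range.mp hi)).2.2
    _ ≤ p.roots.card := Multiset.toFinset_card_le _

/-- TRANSFER (the prover route's last step): if the reduced real cell polynomial `Q_{u,x}` changes sign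
strictly between `d + 1` increasing real points, where `d ≥ deg Q_{u,x}` (e.g. `d = u − 2`, see
`natDegree_cellPolyQ_le`) and `d ≥ 1`, then `P_{u,x}` has only real zeros. -/
theorem realRootedAt_of_alternating {u x d : ℕ} (t : ℕ → ℝ) (ht : ∀ i < d, t i < t (i + 1))
    (hsign : ∀ i < d, (cellPolyQ u x).eval (t i) * (cellPolyQ u x).eval (t (i + 1)) < 0)
    (hdeg : (cellPolyQ u x).natDegree ≤ d) (hd : 0 < d) : RealRootedAt u x := by
  intro z hz
  have hp : cellPolyQ u x ≠ 0 := fun h => by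
    have := hsign 0 hd
    simp [h] at this
  rw [cellPoly_eq_mul_Q] at hz
  rcases mul_eq_zero.mp hz with rfl | hz'
  · simp
  · exact im_eq_zero_of_natDegree_le_card_roots hp
      (hdeg.trans (le_card_roots_of_alternating _ t ht hsign hp)) hz'

/-- Degenerate but useful: if `Q_{u,x}` has degree `≤ 1` and is nonzero, `P_{u,x}` is real-rooted. -/
theorem realRootedAt_of_natDegree_le_one {u x : ℕ} (hdeg : (cellPolyQ u x).natDegree ≤ 1)
    (hne : cellPolyQ u x ≠ 0) : RealRootedAt u x := by
  intro z hz
  rw [cellPoly_eq_mul_Q] at hz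
  rcases mul_eq_zero.mp hz with rfl | hz'
  · simp
  · -- Q = a + b X with real a, b, not both zero
    have hab : ∀ w : ℂ, ((cellPolyQ u x).map (algebraMap ℝ ℂ)).eval w =
        ((cellPolyQ u x).coeff 0 : ℂ) + ((cellPolyQ u x).coeff 1 : ℂ) * w := by
      intro w
      have hq := (cellPolyQ u x).as_sum_range' 2 (by omega)
      conv_lhs => rw [hq]
      simp [Finset.sum_range_succ]
    rw [hab] at hz'
    by_cases hb : (cellPolyQ u x).coeff 1 = 0
    · rw [hb] at hz'
      simp only [Complex.ofReal_zero, zero_mul, add_zero, Complex.ofReal_eq_zero] at hz'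
      exfalso
      apply hne
      refine Polynomial.ext fun i => ?_
      rcases Nat.lt_or_ge i 2 with hi | hi
      · interval_cases i
        · simpa using hz'
        · simpa using hb
      · rw [coeff_zero]
        exact coeff_eq_zero_of_natDegree_lt (by omega)
    · have : z = -((cellPolyQ u x).coeff 0 : ℂ) / ((cellPolyQ u x).coeff 1 : ℂ) := by
        field_simp [Complex.ofReal_ne_zero.mpr hb] 
        linear_combination hz'
      rw [this, ← Complex.ofReal_neg, ← Complex.ofReal_div, Complex.ofReal_im]

/-! ### (B1) the trivially true cases `u = 2, 3` (for all `x ≥ 2`), and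
### (C1) non-monotonicity in `x` at `u = 4`: `x = 26` real-rooted, `x = 27` not -/

/-- At `u = 2` or `u = 3`, `Q` has degree `≤ 1`; it is nonzero as soon as some prime lies in
`(x^{1/u}, x]` — Bertrand supplies one in `(x/2, x]` for `x ≥ 2`. -/
theorem cell_one_pos {u x : ℕ} (hu : 2 ≤ u) (hx : 2 ≤ x) : 0 < cell u x 1 := by
  unfold cell
  rw [Finset.card_pos]
  obtain ⟨p, hp, hxp, hpx⟩ := Nat.exists_prime_lt_and_le_two_mul (x / 2) (by omega)
  refine ⟨p, Finset.mem_filter.mpr ⟨Finset.mem_Icc.mpr ⟨hp.one_lt.le, by omega⟩, ?_,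
    ArithmeticFunction.cardFactors_apply_prime hp⟩⟩
  rw [hp.minFac_eq]
  -- x^{1/u} ≤ x^{1/2} = √x < p since p > x/2 ≥ √x/… : use p² > x
  have hp2 : x < p ^ u := by
    have h2p : x < 2 * p := by omega
    have h2 : x < p ^ 2 := by nlinarith [hp.two_le]
    exact lt_of_lt_of_le h2 (Nat.pow_le_pow_right hp.pos hu)
  have hu' : (0 : ℝ) < u := by exact_mod_cast (show 0 < u by omega)
  rw [one_div, Real.rpow_inv_lt_iff_of_pos (Nat.cast_nonneg _) (Nat.cast_nonneg _) hu', Real.rpow_natCast]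
  exact_mod_cast hp2
/-- (B1) the crux holds at `u = 2` for every `x ≥ 2` (optimal: at `x ≤ 1` the polynomial vanishes). -/

theorem realRootedAt_two (x : ℕ) (hx : 2 ≤ x) : RealRootedAt 2 x := by
  refine realRootedAt_of_natDegree_le_one ((natDegree_cellPolyQ_le 2 x (by norm_num)).trans (by norm_num)) ?_
  intro h
  have := congrArg (fun q => q.coeff 0) h
  simp only [cellPolyQ_coeff, coeff_zero] at this
  simp at this
  exact (cell_one_pos (le_refl 2) hx).ne' this
/-- (B1) the crux holds at `u = 3` for every `x ≥ 2`. -/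

theorem realRootedAt_three (x : ℕ) (hx : 2 ≤ x) : RealRootedAt 3 x := by
  refine realRootedAt_of_natDegree_le_one ((natDegree_cellPolyQ_le 3 x (by norm_num)).trans (by norm_num)) ?_
  intro h
  have := congrArg (fun q => q.coeff 0) h
  simp only [cellPolyQ_coeff, coeff_zero] at this
  simp at this
  exact (cell_one_pos (by norm_num) hx).ne' this

/-- Cells at `u = 4`, `x = 26, 27` (window `2^4 ≤ x < 3^4`, so "rough" = "odd > 1"):
`A_1 = 8` (odd primes ≤ 23), `A_2 = 4` (`9,15,21,25`), `A_3(26) = 0`, `A_3(27) = 1` (`27`). -/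
theorem cells_four_26_27 :
    cell 4 26 1 = 8 ∧ cell 4 26 2 = 4 ∧ cell 4 26 3 = 0 ∧
    cell 4 27 1 = 8 ∧ cell 4 27 2 = 4 ∧ cell 4 27 3 = 1 := by
  have h26 : ∀ j, cell 4 26 j = ((Finset.Icc 1 26).filter (fun n => 3 ≤ Nat.minFac n ∧
      ArithmeticFunction.cardFactors n = j)).card := cell_eq_of_window (B := 3) (by norm_num) (by norm_num) (by norm_num)
  have h27 : ∀ j, cell 4 27 j = ((Finset.Icc 1 27).filter (fun n => 3 ≤ Nat.minFac n ∧
      ArithmeticFunction.cardFactors n = j)).card := cell_eq_of_window (B := 3) (by norm_num) (by norm_num) (by norm_num)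
  simp only [h26, h27]
  refine ⟨?_, ?_, ?_, ?_, ?_, ?_⟩ <;>
  · rw [Finset.card_filter]
    simp [Finset.sum_Icc_succ_top, ArithmeticFunction.cardFactors_apply, Nat.primeFactorsList_ofNat]
    norm_num

/-- (C1a) `P_{4,26}(z) = 8z + 4z²` is real-rooted … -/
theorem realRootedAt_four_26 : RealRootedAt 4 26 := by
  obtain ⟨h1, h2, h3, -, -, -⟩ := cells_four_26_27
  refine realRootedAt_of_natDegree_le_one ?_ ?_
  · rw [natDegree_le_iff_coeff_eq_zero]
    intro N hN
    rw [cellPolyQ_coeff]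
    split_ifs with h
    · interval_cases N
      · simp [h3]
      · simp [cell_eq_zero_of_le (u := 4) (x := 26) (j := 4) (by norm_num) (by norm_num)]
    · rfl
  · intro h
    have := congrArg (fun q => q.coeff 0) h
    simp only [cellPolyQ_coeff, coeff_zero] at this
    simp [h1] at this

/-- (C1b) … but `P_{4,27}(z) = 8z + 4z² + z³ = z((z+2)² + 4)` is not: real-rootedness is NOT
monotone in `x` (so "for all large x" cannot be weakened to "for some x₁ and then inherited"). -/
theorem not_realRootedAt_four_27 : ¬ RealRootedAt 4 27 := by
  obtain ⟨-, -, -, h1, h2, h3⟩ := cells_four_26_27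
  intro h
  obtain ⟨z, hz⟩ : ∃ z : ℂ, z ^ 2 + 4 * z + 8 = 0 := by
    obtain ⟨z, hz⟩ := IsAlgClosed.exists_root (C 1 * X ^ 2 + C 4 * X + C 8 : ℂ[X])
      (by rw [Polynomial.degree_quadratic (by norm_num)]; norm_num)
    exact ⟨z, by simpa [IsRoot] using hz⟩
  have hP : cellPoly 4 27 z = 8 * z + 4 * z ^ 2 + z ^ 3 := by
    simp [cellPoly, Finset.sum_range_succ, cell_zero, h1, h2, h3,
      cell_eq_zero_of_le (u := 4) (x := 27) (j := 4) (by norm_num) (by norm_num)]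
  have him : z.im = 0 := h z (by rw [hP]; linear_combination z * hz)
  have hre : (z.re : ℂ) = z := Complex.ext rfl (by simp [him])
  rw [← hre] at hz
  norm_cast at hz
  nlinarith [sq_nonneg (z.re + 2)]

/-- Real-rootedness of `P_{u,x}` is not monotone in `x`. -/
theorem not_monotone_in_x : ¬ (∀ u x y : ℕ, 2 ≤ u → x ≤ y → RealRootedAt u x → RealRootedAt u y) :=
  fun h => not_realRootedAt_four_27 (h 4 26 27 (by norm_num) (by norm_num) realRootedAt_four_26)

end Summit.Parity.GeneralizedHardyLittlewood.Theorems.ModelHyperbolicity.Negative
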